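import Literature.AnabelianGeometry.SemiGraphs.TemperedAnabelianThm68OriginClosers

/-!
# [SemiAnbd] Cor. 6.9 ⟸ Thm. 6.8 (iv) + Thm. 6.5 + the tempered [GalSect] Lemma 3.1 criterion (kernel check of the printed deduction)

Mochizuki, *Semi-graphs of anabelioids*, Publ. RIMS **42** (2006) [SemiAnbd], §6, Cor. 6.9 (Tempered
Absoluteness of Decomposition Groups for Genus Zero), ms. p. 75: "In the situation of Theorem 6.8, (iv),
suppose further both `X_K` and `Y_L` are defined over a number field.  Then the isomorphism `α` preserves
the decomposition groups of all the closed points."  Printed proof (p. 75 l. −5 – p. 77 l. 2): "Corollary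
6.9 follows from Theorem 6.8, (iv), by applying a similar argument to the argument used in the proof of
[Mzk8], Corollary 3.2.  In the present tempered case, one must therefore verify the tempered analogue of
[Mzk8], Lemma 3.1" — followed by that verification (tower `X_K[j, σ]`, conditions (i)–(iv), Krasner's
lemma, compactness of `X_K[j, σ](K)` via fixed components of the trees `𝒢_j`).  [Mzk8] = *Galois
sections in absolute anabelian geometry*, Nagoya Math. J. **179** (2005), Cor. 3.2, ms. p. 14: "Corollary
3.2 follows formally from Corollary 2.8; Theorem 1.3, (iii), (iv); and the equivalence (i) ⟺ (iv) of
Lemma 3.1." [cite: MochizukiSemiAnbd2006, Cor 6.9 pp.75-77] [cite: MochizukiGalSect2005, Lem 3.1, Cor 3.2 pp.13-14]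

PROOF-ONLY file (no definition, no new named fact; abc-iut cell, layer L3, D-0079 L-F pack D, seat
abc-iut-L3-t7 gen 8; GAP-LEDGER row G-L3t7g7-2).  It kernel-checks the word "formally": the cell's typed
Cor. 6.9 (`TemperedCurve.IsoPreservesAllDecompGenusZeroNF`, the `h69` binder of
`TemperedMorphismOrigin.decompositionPreservationHolds_of_parts`) is DERIVED from the typed Thm. 6.8 (iv),
first sentence (`IsoPreservesAlgebraicDecomp`; print's "Corollary 2.8"), the typed Thm. 6.5 (iii)
(`IsoPreservesCuspidalDecomp`, for `α` and `α⁻¹`), (iv) (`NoncuspidalNotLeCuspidal`) and (ii)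
(`DecompCommensurablyTerminal`) (print's "Theorem 1.3, (iii), (iv)"; (ii) enters through the tacit "we may
always enlarge `K`": an open subgroup of a decomposition group with the same commensurator IS that group,
sub-DAG row T68-B2), the tacit compactness of decomposition groups (sub-DAG row T68-B1 `DecompCompact`),
(hΔ) `α(Δ^temp_X) = Δ^temp_Y` ([Mzk8] Prop. 1.1 (ii), explicit as in every §6 transport file), and ONE
displayed binder per curve (no `def`): the tempered [Mzk8] Lemma 3.1, equivalence (i) ⟺ (iv), which
print PROVES on pp. 75–77 — stated uniformly in the finite extension `K′ ⊇ K` over which the section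
lives (sections `σ : G_{K′} → Π^temp_{X_{K′}}` rendered as compact `D ≤ Π^temp_{X_K}` with
`D ∩ Δ^temp_X = {1}` and `D · Δ^temp_X (= Π^temp_{X_{K′}})` open) and family-free ("for every `j`,
`Im(σ) · Δ^temp_X[j]` contains …" ⟺ "every open `H ⊇ Im(σ)` contains …", because the `Δ^temp_X[j]`
are open, normal in `Π^temp_{X_K}`, and "form a base of the topology of `Δ^temp_X`", p. 75): for `X_K`
defined over a number field and every such `D` inside no cuspidal decomposition group, (i) "`Im(σ) = D_x`,
`x ∈ X_{K′}(K′)`" — `D = γ D_x γ⁻¹ ∩ Π^temp_{X_{K′}}` for a closed point `x` of `X̄_K` — iff (iv) every open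
`H ⊇ D` contains "a decomposition group relative to `Π^temp_{X_{K′}}` of an algebraic closed point that
surjects onto `G_{K′}`" — `γ D_{x′} γ⁻¹ ∩ Π^temp_{X_{K′}} ≤ H`, `x′` algebraic, `γ D_{x′} γ⁻¹ · Δ^temp_X ⊇ Π^temp_{X_{K′}}`.

The deduction (`isoPreservesAllDecompGenusZeroNF_of_sectionCriterion`): cusps by Thm. 6.5 (iii); for
non-cuspidal `x`, `α(D_x)` is again a section over an open subgroup of `G_L` ((hΔ) and the interface laws
"`D_x ↠` open subgroup of `G_K`", "`I_x = {1}`"), inside no cuspidal decomposition group (Thm. 6.5 (iii)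
for `α⁻¹`, (iv)), and satisfies (iv) because `D_x` does and `α` carries algebraic decomposition groups to
algebraic ones (Thm. 6.8 (iv)); so (iv) ⇒ (i) for `Y_L` puts `α(D_x)` inside some `D_y`; the same for
`α⁻¹` puts `D_x ≤ α⁻¹(D_y)` inside some `D_{x″}` with finite index, whence equality (Thm. 6.5 (ii)).
HONEST FRAMING: reduced ≠ proved — the criterion is an assumption LABEL on OUR typed statements (its
printed proof, Krasner's lemma + compactness of fixed loci on the trees `𝒢_j` via Thm. 3.7 / 5.4 /
Lem. 1.8 (ii), is scheme-side and not in the tree); nothing of [SemiAnbd] §6 / [Mzk8] is asserted;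
no statement is strengthened; nothing here takes a side on [IUTchIII] Cor. 3.12.
-/

noncomputable section

namespace Literature.AnabelianGeometry.SemiGraphs

open scoped Pointwise
open Topology

variable {p : ℕ} [Fact p.Prime]

namespace TemperedCurve

variable {X Y : TemperedCurve p}

/-- `D_x · Δ^temp_X = aug⁻¹(aug(D_x))` is an OPEN subgroup of `Π^temp_{X_K}` ("`D_x` always surjects
onto an open subgroup of `G_K`", p. 71: it is `Π^temp_{X_{K(x)}}`). [cite: MochizukiSemiAnbd2006, §6 p.71] -/
theorem isOpen_decomp_sup_deltaTemp (X : TemperedCurve p) (x : X.Pt) :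
    IsOpen ((X.decomp x ⊔ X.DeltaTemp : Subgroup X.PiTemp) : Set X.PiTemp) := by
  have h : X.decomp x ⊔ X.DeltaTemp =
      ((X.decomp x).map X.aug.toMonoidHom).comap X.aug.toMonoidHom := by
    rw [Subgroup.comap_map_eq]
    rfl
  rw [h, Subgroup.coe_comap, Subgroup.coe_map]
  exact (X.isOpen_aug_decomp x).preimage X.aug.continuous

/-- For a non-cuspidal closed point, `D_x ∩ Δ^temp_X = {1}` (p. 71). [cite: MochizukiSemiAnbd2006, §6 p.71] -/
theorem decomp_inf_deltaTemp_eq_bot (X : TemperedCurve p) {x : X.Pt} (hx : ¬ X.IsCusp x) :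
    X.decomp x ⊓ X.DeltaTemp = ⊥ :=
  X.inertia_eq_bot x hx

/-- Thm. 6.5 (iv) at the representative `D_x` of a non-cusp. [cite: MochizukiSemiAnbd2006, Thm 6.5(iv) p.72] -/
theorem not_decomp_le_smul_cuspidal (hiv : X.NoncuspidalNotLeCuspidal) {x : X.Pt}
    (hx : ¬ X.IsCusp x) (c : X.Pt) (hc : X.IsCusp c) (γ : ConjAct X.PiTemp) :
    ¬ X.decomp x ≤ γ • X.decomp c := by
  simpa only [one_smul] using hiv x c hx hc 1 γ

/-- If `H ∩ Δ^temp_X = {1}` and `D ≤ H`, then `H ∩ (D · Δ^temp_X) = D` (an element `d δ` of `H` with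
`d ∈ D` has `δ ∈ H ∩ Δ^temp_X = {1}`) — the step "`Im(σ) = D_x ∩ Π^temp_{X_{K′}}`" of Lemma 3.1 (i)
read over `K′`. [cite: MochizukiGalSect2005, Lem 3.1 (i) p.13] -/
theorem inf_sup_deltaTemp_eq_of_le {D H : Subgroup X.PiTemp} (hH : H ⊓ X.DeltaTemp = ⊥) (hDH : D ≤ H) :
    H ⊓ (D ⊔ X.DeltaTemp) = D := by
  haveI : X.DeltaTemp.Normal := MonoidHom.normal_ker X.aug.toMonoidHom
  refine le_antisymm ?_ (le_inf hDH le_sup_left)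
  intro g hg
  obtain ⟨hgH, hgsup⟩ := Subgroup.mem_inf.mp hg
  obtain ⟨d, hd, δ, hδ, rfl⟩ := Subgroup.mem_sup_of_normal_right.mp hgsup
  have hδH : δ ∈ H := by
    have := H.mul_mem (H.inv_mem (hDH hd)) hgH
    rwa [inv_mul_cancel_left] at this
  have hδ1 : δ ∈ (H ⊓ X.DeltaTemp : Subgroup X.PiTemp) := Subgroup.mem_inf.mpr ⟨hδH, hδ⟩
  rw [hH, Subgroup.mem_bot] at hδ1
  simpa only [hδ1, mul_one] using hd

/-- A conjugate `γ D_x γ⁻¹` of a non-cuspidal decomposition group still meets `Δ^temp_X` trivially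
(`Δ^temp_X` is normal). [cite: MochizukiSemiAnbd2006, §6 p.71] -/
theorem smul_decomp_inf_deltaTemp_eq_bot (X : TemperedCurve p) {x : X.Pt} (hx : ¬ X.IsCusp x)
    (γ : ConjAct X.PiTemp) : γ • X.decomp x ⊓ X.DeltaTemp = ⊥ := by
  haveI : X.DeltaTemp.Normal := MonoidHom.normal_ker X.aug.toMonoidHom
  rw [eq_bot_iff]
  intro g hg
  obtain ⟨hgD, hgΔ⟩ := Subgroup.mem_inf.mp hg
  obtain ⟨d, hd, rfl⟩ := (Subgroup.mem_smul_pointwise_iff_exists _ _ _).mp hgD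
  have hdΔ : d ∈ X.DeltaTemp := by
    rw [ConjAct.smul_def] at hgΔ
    have := Subgroup.Normal.conj_mem inferInstance _ hgΔ (ConjAct.ofConjAct γ)⁻¹
    simpa [mul_assoc] using this
  have hd1 : d ∈ (X.decomp x ⊓ X.DeltaTemp : Subgroup X.PiTemp) := Subgroup.mem_inf.mpr ⟨hd, hdΔ⟩
  rw [X.decomp_inf_deltaTemp_eq_bot hx, Subgroup.mem_bot] at hd1
  rw [hd1, smul_one, Subgroup.mem_bot]

/-- A conjugate of a compact decomposition group (T68-B1) is compact. [cite: MochizukiSemiAnbd2006, §6 p.71] -/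
theorem isCompact_smul_decomp (hc : Thm68Sub.DecompCompact X) (x : X.Pt) (γ : ConjAct X.PiTemp) :
    IsCompact ((γ • X.decomp x : Subgroup X.PiTemp) : Set X.PiTemp) := by
  have h := Thm68Sub.isCompact_map (Thm68Sub.conjCME (ConjAct.ofConjAct γ)) (hc x)
  rwa [Thm68Sub.map_conjCME, ConjAct.toConjAct_ofConjAct] at h

section Transport

variable (α : X.PiTemp ≃ₜ* Y.PiTemp)

/-- `α(D ∩ Δ^temp_X) = α(D) ∩ Δ^temp_Y` under (hΔ). [cite: MochizukiSemiAnbd2006, Thm 6.8 p.74] -/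
theorem map_inf_deltaTemp_of_hΔ (hΔ : X.DeltaTemp.map α.toMulEquiv.toMonoidHom = Y.DeltaTemp)
    (D : Subgroup X.PiTemp) :
    (D ⊓ X.DeltaTemp).map α.toMulEquiv.toMonoidHom = D.map α.toMulEquiv.toMonoidHom ⊓ Y.DeltaTemp := by
  rw [Subgroup.map_inf_eq _ _ _ α.injective, hΔ]

/-- `α(D · Δ^temp_X) = α(D) · Δ^temp_Y` under (hΔ). [cite: MochizukiSemiAnbd2006, Thm 6.8 p.74] -/
theorem map_sup_deltaTemp_of_hΔ (hΔ : X.DeltaTemp.map α.toMulEquiv.toMonoidHom = Y.DeltaTemp)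
    (D : Subgroup X.PiTemp) :
    (D ⊔ X.DeltaTemp).map α.toMulEquiv.toMonoidHom = D.map α.toMulEquiv.toMonoidHom ⊔ Y.DeltaTemp := by
  rw [Subgroup.map_sup, hΔ]

/-- Openness is transported along an isomorphism of topological groups. [cite: MochizukiSemiAnbd2006, Thm 6.8 p.74] -/
theorem isOpen_map_of_isOpen {H : Subgroup X.PiTemp} (hH : IsOpen (H : Set X.PiTemp)) :
    IsOpen ((H.map α.toMulEquiv.toMonoidHom : Subgroup Y.PiTemp) : Set Y.PiTemp) := by
  rw [Subgroup.coe_map]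
  exact α.toHomeomorph.isOpenMap _ hH

/-- `(γ • D).map α = α(γ) • D.map α` for `γ : ConjAct`. [cite: MochizukiSemiAnbd2006, Thm 6.8 p.74] -/
theorem map_conjAct_smul (γ : ConjAct X.PiTemp) (D : Subgroup X.PiTemp) :
    (γ • D).map α.toMulEquiv.toMonoidHom =
      ConjAct.toConjAct (α (ConjAct.ofConjAct γ)) • D.map α.toMulEquiv.toMonoidHom := by
  have h := Thm68Sub.map_smul_eq α.toMulEquiv.toMonoidHom (ConjAct.ofConjAct γ) D
  rw [ConjAct.toConjAct_ofConjAct] at h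
  exact h

end Transport

section Criterion

variable (aX : X.CurveArithmeticFlags) (aY : Y.CurveArithmeticFlags)

/- The two DISPLAYED BINDERS (no `def`): the tempered [Mzk8] Lemma 3.1, (i) ⟺ (iv), for `X_K` and for
`Y_L`, uniform in `K′` and family-free — see the module docstring; [SemiAnbd] pp. 75–77. -/
variable
  (hcritX : aX.IsDefinedOverNumberField →
    ∀ D : Subgroup X.PiTemp, IsCompact (D : Set X.PiTemp) → D ⊓ X.DeltaTemp = ⊥ →
      IsOpen ((D ⊔ X.DeltaTemp : Subgroup X.PiTemp) : Set X.PiTemp) →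
      (∀ c : X.Pt, X.IsCusp c → ∀ γ : ConjAct X.PiTemp, ¬ D ≤ γ • X.decomp c) →
      ((∃ x : X.Pt, ∃ γ : ConjAct X.PiTemp, D = γ • X.decomp x ⊓ (D ⊔ X.DeltaTemp)) ↔
        ∀ H : Subgroup X.PiTemp, IsOpen (H : Set X.PiTemp) → D ≤ H →
          ∃ x' : X.Pt, aX.IsAlgebraicPt x' ∧ ∃ γ : ConjAct X.PiTemp,
            γ • X.decomp x' ⊓ (D ⊔ X.DeltaTemp) ≤ H ∧
              D ⊔ X.DeltaTemp ≤ γ • X.decomp x' ⊔ X.DeltaTemp))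
  (hcritY : aY.IsDefinedOverNumberField →
    ∀ D : Subgroup Y.PiTemp, IsCompact (D : Set Y.PiTemp) → D ⊓ Y.DeltaTemp = ⊥ →
      IsOpen ((D ⊔ Y.DeltaTemp : Subgroup Y.PiTemp) : Set Y.PiTemp) →
      (∀ c : Y.Pt, Y.IsCusp c → ∀ γ : ConjAct Y.PiTemp, ¬ D ≤ γ • Y.decomp c) →
      ((∃ y : Y.Pt, ∃ γ : ConjAct Y.PiTemp, D = γ • Y.decomp y ⊓ (D ⊔ Y.DeltaTemp)) ↔
        ∀ H : Subgroup Y.PiTemp, IsOpen (H : Set Y.PiTemp) → D ≤ H →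
          ∃ y' : Y.Pt, aY.IsAlgebraicPt y' ∧ ∃ γ : ConjAct Y.PiTemp,
            γ • Y.decomp y' ⊓ (D ⊔ Y.DeltaTemp) ≤ H ∧
              D ⊔ Y.DeltaTemp ≤ γ • Y.decomp y' ⊔ Y.DeltaTemp))

include hcritX hcritY

/-- **Core step of [Mzk8] Cor. 3.2 / [SemiAnbd] Cor. 6.9** (one isomorphism, one non-cuspidal point,
containment only): under (hΔ), Thm. 6.5 (iii) for `α⁻¹`, Thm. 6.5 (iv) for `X_K`, compact `D_x`
(T68-B1), Thm. 6.8 (iv) for `α` (both curves isogenous to genus zero), and the tempered Lemma 3.1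
criterion (i) ⟺ (iv) for `X_K` and for `Y_L` (both defined over a number field; the displayed
binders `hcritX`, `hcritY`, [SemiAnbd] pp. 75–77), the image `α(D_x)` of the decomposition group of a
non-cuspidal closed point `x` of `X̄_K` is contained in a conjugate of the decomposition group of a
non-cuspidal closed point `y` of `Ȳ_L`: `α(D_x)` is again (the image of) a section over an open
subgroup of `G_L`, not inside a cuspidal decomposition group, and satisfies (iv) because `D_x` does
and `α` carries algebraic decomposition groups to algebraic ones; then (iv) ⇒ (i) for `Y_L`.
[cite: MochizukiSemiAnbd2006, Cor 6.9 pp.75-77] [cite: MochizukiGalSect2005, Cor 3.2 p.14] -/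
theorem map_decomp_le_smul_decomp_of_sectionCriterion (α : X.PiTemp ≃ₜ* Y.PiTemp)
    (hΔ : X.DeltaTemp.map α.toMulEquiv.toMonoidHom = Y.DeltaTemp)
    (h65' : Y.IsoPreservesCuspidalDecomp X) (hiv : X.NoncuspidalNotLeCuspidal)
    (hc : Thm68Sub.DecompCompact X) (hIV : X.IsoPreservesAlgebraicDecomp Y aX aY α)
    (hgX : aX.IsIsogenousToGenusZero) (hgY : aY.IsIsogenousToGenusZero)
    (hnfX : aX.IsDefinedOverNumberField) (hnfY : aY.IsDefinedOverNumberField)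
    {x : X.Pt} (hx : ¬ X.IsCusp x) :
    ∃ y : Y.Pt, ¬ Y.IsCusp y ∧ ∃ γ : ConjAct Y.PiTemp,
      (X.decomp x).map α.toMulEquiv.toMonoidHom ≤ γ • Y.decomp y := by
  set E : Subgroup Y.PiTemp := (X.decomp x).map α.toMulEquiv.toMonoidHom with hE
  -- (a) `E` is compact
  have hEc : IsCompact (E : Set Y.PiTemp) := Thm68Sub.isCompact_map α (hc x)
  -- (b) `E ∩ Δ^temp_Y = {1}`
  have hEΔ : E ⊓ Y.DeltaTemp = ⊥ := by
    rw [hE, ← map_inf_deltaTemp_of_hΔ α hΔ, X.decomp_inf_deltaTemp_eq_bot hx, Subgroup.map_bot]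
  -- (c) `E · Δ^temp_Y` is open
  have hEo : IsOpen ((E ⊔ Y.DeltaTemp : Subgroup Y.PiTemp) : Set Y.PiTemp) := by
    rw [hE, ← map_sup_deltaTemp_of_hΔ α hΔ]
    exact isOpen_map_of_isOpen α (X.isOpen_decomp_sup_deltaTemp x)
  -- (d) `E` is contained in no cuspidal decomposition group of `Y_L` (Thm. 6.5 (iii) for `α⁻¹`, (iv))
  have hEnc : ∀ c : Y.Pt, Y.IsCusp c → ∀ γ : ConjAct Y.PiTemp, ¬ E ≤ γ • Y.decomp c := by
    intro c hc' γ hle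
    have hcusp : Y.IsCuspidalDecompositionGroup (γ • Y.decomp c) := ⟨c, hc', γ, rfl⟩
    obtain ⟨c₀, hc₀, γ₀, hγ₀⟩ := (h65' α.symm (γ • Y.decomp c)).1 hcusp
    have hle' : X.decomp x ≤ γ₀ • X.decomp c₀ := by
      rw [← hγ₀, ← Thm68Sub.map_map_symm α (X.decomp x)]
      exact Subgroup.map_mono hle
    exact not_decomp_le_smul_cuspidal hiv hx c₀ hc₀ γ₀ hle'
  -- (e) condition (iv) holds for `E`: transported from (i) ⇒ (iv) for `D_x`, via Thm. 6.8 (iv)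
  have hxnc : ∀ c : X.Pt, X.IsCusp c → ∀ γ : ConjAct X.PiTemp, ¬ X.decomp x ≤ γ • X.decomp c :=
    fun c hc' γ => not_decomp_le_smul_cuspidal hiv hx c hc' γ
  have hxi : ∃ x₁ : X.Pt, ∃ γ : ConjAct X.PiTemp,
      X.decomp x = γ • X.decomp x₁ ⊓ (X.decomp x ⊔ X.DeltaTemp) :=
    ⟨x, 1, by rw [one_smul]; exact (inf_eq_left.mpr le_sup_left).symm⟩
  have hxiv := (hcritX hnfX (X.decomp x) (hc x) (X.decomp_inf_deltaTemp_eq_bot hx)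
    (X.isOpen_decomp_sup_deltaTemp x) hxnc).1 hxi
  have hEiv : ∀ H : Subgroup Y.PiTemp, IsOpen (H : Set Y.PiTemp) → E ≤ H →
      ∃ y' : Y.Pt, aY.IsAlgebraicPt y' ∧ ∃ γ : ConjAct Y.PiTemp,
        γ • Y.decomp y' ⊓ (E ⊔ Y.DeltaTemp) ≤ H ∧ E ⊔ Y.DeltaTemp ≤ γ • Y.decomp y' ⊔ Y.DeltaTemp := by
    intro H hHo hEH
    -- pull `H` back to `Π^temp_{X_K}`
    have hH'o : IsOpen ((H.comap α.toMulEquiv.toMonoidHom : Subgroup X.PiTemp) : Set X.PiTemp) := by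
      rw [Subgroup.coe_comap]
      exact hHo.preimage α.continuous
    have hxH' : X.decomp x ≤ H.comap α.toMulEquiv.toMonoidHom := by
      rw [← Subgroup.map_le_iff_le_comap]
      exact hEH
    obtain ⟨x', hx'alg, γ', h1, h2⟩ := hxiv _ hH'o hxH'
    -- transport the algebraic decomposition group along `α` (Thm. 6.8 (iv))
    have halg : ∃ x₁ ∈ {x₁ : X.Pt | aX.IsAlgebraicPt x₁}, ∃ γ : ConjAct X.PiTemp,
        γ' • X.decomp x' = γ • X.decomp x₁ := ⟨x', hx'alg, γ', rfl⟩
    obtain ⟨y', hy'alg, γ'', h3⟩ := (hIV hgX hgY (γ' • X.decomp x')).1 halg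
    refine ⟨y', hy'alg, γ'', ?_, ?_⟩
    · rw [← h3, hE, ← map_sup_deltaTemp_of_hΔ α hΔ, ← Subgroup.map_inf_eq _ _ _ α.injective]
      exact (Subgroup.map_mono h1).trans (Subgroup.map_comap_le _ _)
    · rw [← h3, hE, ← map_sup_deltaTemp_of_hΔ α hΔ, ← map_sup_deltaTemp_of_hΔ α hΔ]
      exact Subgroup.map_mono h2
  -- (f) (iv) ⇒ (i) for `Y_L`
  obtain ⟨y, γ, hEy⟩ := (hcritY hnfY E hEc hEΔ hEo hEnc).2 hEiv
  have hEle : E ≤ γ • Y.decomp y := by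
    rw [hEy]
    exact inf_le_left
  exact ⟨y, fun hy => hEnc y hy γ hEle, γ, hEle⟩

/-- **[SemiAnbd] Cor. 6.9 / [Mzk8] Cor. 3.2, pointwise form**: under (hΔ), Thm. 6.5 (iii) (both
directions), (iv) (both curves), (ii) for `X_K`, compact decomposition groups (T68-B1, both curves),
Thm. 6.8 (iv) for `α`, and the tempered Lemma 3.1 criterion for both curves (displayed binders), `α`
carries the decomposition group of EVERY closed point `x` of `X̄_K` onto a conjugate of the
decomposition group of a closed point of `Ȳ_L` — cusps by Thm. 6.5 (iii); non-cusps by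
`map_decomp_le_smul_decomp_of_sectionCriterion` for `α` and for `α⁻¹` ("we may always enlarge `K`":
`D_x ≤ α⁻¹(γ D_y γ⁻¹) ≤ δ D_{x″} δ⁻¹`, of finite index since `D_x` is relatively open in the compact
`δ D_{x″} δ⁻¹` — `I_{x″} = {1}` and `D_x · Δ^temp_X` open), then commensurable terminality
(Thm. 6.5 (ii), T68-B2) forces equality. [cite: MochizukiSemiAnbd2006, Cor 6.9 pp.75-77]
[cite: MochizukiGalSect2005, Cor 3.2 p.14] -/
theorem map_decomp_eq_smul_decomp_of_sectionCriterion (α : X.PiTemp ≃ₜ* Y.PiTemp)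
    (hΔ : X.DeltaTemp.map α.toMulEquiv.toMonoidHom = Y.DeltaTemp)
    (h65 : X.IsoPreservesCuspidalDecomp Y) (h65' : Y.IsoPreservesCuspidalDecomp X)
    (hiv : X.NoncuspidalNotLeCuspidal) (hiv' : Y.NoncuspidalNotLeCuspidal)
    (hct : X.DecompCommensurablyTerminal)
    (hc : Thm68Sub.DecompCompact X) (hc' : Thm68Sub.DecompCompact Y)
    (hIV : X.IsoPreservesAlgebraicDecomp Y aX aY α)
    (hgX : aX.IsIsogenousToGenusZero) (hgY : aY.IsIsogenousToGenusZero)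
    (hnfX : aX.IsDefinedOverNumberField) (hnfY : aY.IsDefinedOverNumberField) (x : X.Pt) :
    ∃ y : Y.Pt, ∃ γ : ConjAct Y.PiTemp,
      (X.decomp x).map α.toMulEquiv.toMonoidHom = γ • Y.decomp y := by
  by_cases hx : X.IsCusp x
  · -- cusps: Thm. 6.5 (iii)
    have hcusp : X.IsCuspidalDecompositionGroup (X.decomp x) := ⟨x, hx, 1, (one_smul _ _).symm⟩
    obtain ⟨y, -, γ, hγ⟩ := (h65 α (X.decomp x)).1 hcusp
    exact ⟨y, γ, hγ⟩
  · -- non-cusps: containment for `α`, then for `α⁻¹`, then commensurable terminality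
    obtain ⟨y, hy, γ, hle⟩ := map_decomp_le_smul_decomp_of_sectionCriterion aX aY hcritX hcritY α hΔ
      h65' hiv hc hIV hgX hgY hnfX hnfY hx
    -- the same hypotheses for `α⁻¹`
    have hΔ' : Y.DeltaTemp.map α.symm.toMulEquiv.toMonoidHom = X.DeltaTemp :=
      Thm68Sub.deltaTemp_map_symm α hΔ
    have hIV' : Y.IsoPreservesAlgebraicDecomp X aY aX α.symm := by
      intro _ _ D
      have h := hIV hgX hgY (D.map α.symm.toMulEquiv.toMonoidHom)
      rw [DLocObj.map_symm_map] at h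
      exact h.symm
    obtain ⟨x'', -, δ, hle'⟩ := map_decomp_le_smul_decomp_of_sectionCriterion aY aX hcritY hcritX
      α.symm hΔ' h65 hiv' hc' hIV' hgY hgX hnfY hnfX hy
    -- `D_x ≤ F := α⁻¹(γ • D_y) ≤ δ' • D_{x''}`
    set F : Subgroup X.PiTemp := (γ • Y.decomp y).map α.symm.toMulEquiv.toMonoidHom with hF
    have hxF : X.decomp x ≤ F := by
      rw [hF, ← Thm68Sub.map_map_symm α (X.decomp x)]
      exact Subgroup.map_mono hle
    set δ' : ConjAct X.PiTemp := ConjAct.toConjAct (α.symm (ConjAct.ofConjAct γ)) * δ with hδ'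
    have hFle : F ≤ δ' • X.decomp x'' := by
      rw [hF, map_conjAct_smul, hδ', mul_smul]
      exact Subgroup.pointwise_smul_le_pointwise_smul_iff.mpr hle'
    have hxle : X.decomp x ≤ δ' • X.decomp x'' := hxF.trans hFle
    -- `x''` is not a cusp (Thm. 6.5 (iv))
    have hx''nc : ¬ X.IsCusp x'' := fun h => not_decomp_le_smul_cuspidal hiv hx x'' h δ' hxle
    -- `D_x` is relatively open, hence of finite index, in the compact `δ' • D_{x''}`
    have hinf : δ' • X.decomp x'' ⊓ (X.decomp x ⊔ X.DeltaTemp) = X.decomp x :=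
      inf_sup_deltaTemp_eq_of_le (X.smul_decomp_inf_deltaTemp_eq_bot hx''nc δ') hxle
    have hopen : IsOpen (((X.decomp x).subgroupOf (δ' • X.decomp x'') :
        Subgroup ↥(δ' • X.decomp x'')) : Set ↥(δ' • X.decomp x'')) := by
      have hset : (((X.decomp x).subgroupOf (δ' • X.decomp x'') : Subgroup ↥(δ' • X.decomp x'')) :
          Set ↥(δ' • X.decomp x'')) =
          Subtype.val ⁻¹' ((X.decomp x ⊔ X.DeltaTemp : Subgroup X.PiTemp) : Set X.PiTemp) := by
        ext ⟨g, hg⟩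
        simp only [Subgroup.coe_subgroupOf, Set.mem_preimage, SetLike.mem_coe,
          Subgroup.coe_subtype]
        constructor
        · intro h
          exact Subgroup.mem_sup_left h
        · intro h
          have : g ∈ δ' • X.decomp x'' ⊓ (X.decomp x ⊔ X.DeltaTemp) := Subgroup.mem_inf.mpr ⟨hg, h⟩
          rwa [hinf] at this
      rw [hset]
      exact (X.isOpen_decomp_sup_deltaTemp x).preimage continuous_subtype_val
    have hfi : ((X.decomp x).subgroupOf (δ' • X.decomp x'')).FiniteIndex :=
      Thm68Sub.finiteIndex_subgroupOf_of_isOpen (isCompact_smul_decomp hc x'' δ') hopen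
    have hfi₀ : ((X.decomp x).subgroupOf (X.decomp x)).FiniteIndex := by
      rw [Subgroup.subgroupOf_self]
      infer_instance
    -- commensurable terminality of `D_x` (Thm. 6.5 (ii)) forces equality
    have hge : δ' • X.decomp x'' ≤ X.decomp x :=
      Thm68Sub.le_of_finiteIndex_le_of_commensurator_eq hxle hfi le_rfl hfi₀ (hct x)
    have hFeq : F = X.decomp x := le_antisymm (hFle.trans hge) hxF
    refine ⟨y, γ, ?_⟩
    rw [← hFeq, hF]
    exact DLocObj.map_symm_map α (γ • Y.decomp y)

/-- **[SemiAnbd] Cor. 6.9 AS TYPED, from the named inputs** (`IsoPreservesAllDecompGenusZeroNF X Y aX aY α`: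
both curves isogenous to genus zero → both defined over a number field → `α` carries the set of
decomposition groups of closed points of `X̄_K` exactly onto that of `Ȳ_L`): the kernel check of
"Corollary 6.9 follows from Theorem 6.8, (iv), by applying [the argument of] [Mzk8], Corollary 3.2"
(p. 75) = "follows formally from Corollary 2.8; Theorem 1.3, (iii), (iv); and the equivalence
(i) ⟺ (iv) of Lemma 3.1" ([Mzk8] p. 14), with the tempered Lemma 3.1 criterion (pp. 75–77) as the
displayed binders `hcritX`, `hcritY`, plus Thm. 6.5 (ii) and T68-B1 for the tacit "enlarge `K`" step.
Nothing of [SemiAnbd]/[Mzk8] is asserted. [cite: MochizukiSemiAnbd2006, Cor 6.9 pp.75-77]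
[cite: MochizukiGalSect2005, Lem 3.1, Cor 3.2 pp.13-14] -/
theorem isoPreservesAllDecompGenusZeroNF_of_sectionCriterion (α : X.PiTemp ≃ₜ* Y.PiTemp)
    (hΔ : X.DeltaTemp.map α.toMulEquiv.toMonoidHom = Y.DeltaTemp)
    (h65 : X.IsoPreservesCuspidalDecomp Y) (h65' : Y.IsoPreservesCuspidalDecomp X)
    (hiv : X.NoncuspidalNotLeCuspidal) (hiv' : Y.NoncuspidalNotLeCuspidal)
    (hct : X.DecompCommensurablyTerminal) (hct' : Y.DecompCommensurablyTerminal)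
    (hc : Thm68Sub.DecompCompact X) (hc' : Thm68Sub.DecompCompact Y)
    (hIV : X.IsoPreservesAlgebraicDecomp Y aX aY α) :
    X.IsoPreservesAllDecompGenusZeroNF Y aX aY α := by
  intro hgX hgY hnfX hnfY D
  -- the same data for `α⁻¹`
  have hΔ' : Y.DeltaTemp.map α.symm.toMulEquiv.toMonoidHom = X.DeltaTemp :=
    Thm68Sub.deltaTemp_map_symm α hΔ
  have hIV' : Y.IsoPreservesAlgebraicDecomp X aY aX α.symm := by
    intro _ _ D'
    have h := hIV hgX hgY (D'.map α.symm.toMulEquiv.toMonoidHom)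
    rw [DLocObj.map_symm_map] at h
    exact h.symm
  constructor
  · rintro ⟨x, -, γ, rfl⟩
    obtain ⟨y, γ', hγ'⟩ := map_decomp_eq_smul_decomp_of_sectionCriterion aX aY hcritX hcritY α hΔ
      h65 h65' hiv hiv' hct hc hc' hIV hgX hgY hnfX hnfY x
    refine ⟨y, Set.mem_univ y, ConjAct.toConjAct (α (ConjAct.ofConjAct γ)) * γ', ?_⟩
    rw [map_conjAct_smul, hγ', mul_smul]
  · rintro ⟨y, -, γ, hγ⟩
    obtain ⟨x, γ', hγ'⟩ := map_decomp_eq_smul_decomp_of_sectionCriterion aY aX hcritY hcritX α.symm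
      hΔ' h65' h65 hiv' hiv hct' hc' hc hIV' hgY hgX hnfY hnfX y
    refine ⟨x, Set.mem_univ x, ConjAct.toConjAct (α.symm (ConjAct.ofConjAct γ)) * γ', ?_⟩
    rw [← Thm68Sub.map_map_symm α D, hγ, map_conjAct_smul, hγ', mul_smul]

end Criterion

end TemperedCurve

end Literature.AnabelianGeometry.SemiGraphs

end
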